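import Mathlib
import Summits.ResolutionOfSingularities.ResolutionOfSingularities.Theorems.CleanModels.Negative.CossartPiltant2019Thm15iFrameOrdDerivations
import HarnessLib

/-!
# Towards `CurveBlowupFacts 5`: residues of a curve blow-up that are `p`-th powers in `κ(ord_𝔪)` (CurveBlowupFacts (b))

Support file (INPUTS seat res-inputs-p-cp15frame g2, 2026-08-28) for the residual hypothesis `CurveBlowupFacts 5` of
`CossartPiltant2019_thm_1_5_i_frame_false_of_curveBlowupFacts` (RETIRED statement F-110, crux `CleanModels`,
stmt-ResolutionOfSingularities-15917).  For the curve blow-up `B♯ = R[θ]_{centre}` (`θ = v/u₀`) along `O = ord_𝔪`: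

* `OrdWitness.constEval`, `OrdWitness.ev0` — «value at the origin» `R = range (S → K) → 𝔽_p`, with `s ≡ ev0 s (mod 𝔪_R)`
  (`OrdWitness.sub_const_mem_maximalIdeal`); hence every element of the chart is `f(θ)` up to order `> 0` for a polynomial `f`
  with CONSTANT coefficients (`OrdWitness.ordVK_aeval_sub_aeval_map_lt_one`);
* `OrdWitness.eq_zero_of_ordVK_aeval_lt_one` — a nonzero `g ∈ 𝔽_p[T]` has `ord g(θ) = 0` (quasi-regularity);
* `OrdWitness.ordVK_mul_pd_theta` — for the good index `b` (`…OrdDerivations.exists_ordVK_wronskian_eq`) the derivation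
  `D = u₀ ∂_b` has `ord (Dθ) = 0`;
* **`OrdWitness.exists_pow_of_Bsharp` — CurveBlowupFacts (b)**: if `u ∈ B♯` and `d ∈ K` have `ord (u − d^p) > 0` then
  `ord (u − e^p) > 0` for some `e ∈ B♯`.  Proof: `u ≡ A₀(θ)/Z₀(θ)` with `A₀, Z₀ ∈ 𝔽_p[T]`; applying `D` (which kills `d^p` and has
  `ord (Dh) ≥ ord h`) gives `ord ((Z₀A₀′ − A₀Z₀′)(θ) · Dθ) > 0`, so `Z₀A₀′ = A₀Z₀′`, so `(A₀Z₀^{p−1})′ = 0`, so `A₀Z₀^{p−1} = H₀^p`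
  (`Polynomial.expand_contract`, `ZMod.expand_card`), and `e = H₀(θ)/Z₀(θ)` works.

Nothing here proves or refutes resolution of singularities in characteristic `p`; [OURS · NEGATIVE-SUPPORT] counted 0.
-/

noncomputable section

set_option linter.dupNamespace false -- mandated namespace of this single-conjunct summit

open MvPolynomial IsLocalRing
open Literature.AlgebraicGeometry.Resolution Literature.AlgebraicGeometry.Resolution.WeightedBlowup

namespace Summit.ResolutionOfSingularities.ResolutionOfSingularities.Theorems.CleanModels.Negative

namespace OrdWitness

variable (p : ℕ) [hp : Fact p.Prime]

/-! ## 1. Constants: `𝔽_p → R` and the value at the origin `R → 𝔽_p` -/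

/-- The constants `𝔽_p → R = range (S → K)`. [folklore] -/
def constι : ZMod p →+* Rg p := (toRange p).comp (C : ZMod p →+* Poly p)

/-- `constι c = c` in `K`. [folklore] -/
theorem coe_constι (c : ZMod p) : ((constι p c : Rg p) : K p) = algebraMap (ZMod p) (K p) c := by
  change ((toRange p (C c) : Rg p) : K p) = _
  rw [coe_toRange, IsScalarTower.algebraMap_apply (ZMod p) (Poly p) (K p), MvPolynomial.algebraMap_eq]

/-- A polynomial over `𝔽_p` evaluates at `θ` like its image over `R`. [folklore] -/
theorem aeval_map_constι (t : K p) (g : Polynomial (ZMod p)) :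
    Polynomial.aeval t (g.map (constι p)) = Polynomial.aeval t g := by
  rw [Polynomial.aeval_def, Polynomial.aeval_def, Polynomial.eval₂_map]
  congr 1
  exact Subsingleton.elim _ _

/-- **Value at the origin on `S`**: `a/t ↦ a(0)/t(0)`. [folklore] -/
def constEval : S p →+* ZMod p :=
  IsLocalization.lift (M := (origin p).primeCompl) (g := (constantCoeff : Poly p →+* ZMod p))
    fun y => isUnit_iff_ne_zero.mpr fun h => y.2 (RingHom.mem_ker.mpr h)

/-- **Value at the origin on `R = range (S → K)`.** [folklore] -/
def ev0 : Rg p →+* ZMod p := (constEval p).comp (rangeEquiv p).symm.toRingHom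

/-- **`s ≡ ev0 s (mod 𝔪_R)`.** [folklore] -/
theorem sub_const_mem_maximalIdeal (s : Rg p) : s - constι p (ev0 p s) ∈ maximalIdeal (Rg p) := by
  obtain ⟨s', rfl⟩ := (rangeEquiv p).surjective s
  obtain ⟨⟨a, t⟩, hat⟩ := IsLocalization.mk'_surjective (origin p).primeCompl s'
  change IsLocalization.mk' (S p) a t = s' at hat
  subst hat
  set c := ev0 p (rangeEquiv p (IsLocalization.mk' (S p) a t)) with hc
  have hc' : constEval p (IsLocalization.mk' (S p) a t) = c := by
    rw [hc, ev0, RingHom.comp_apply]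
    simp
  have hspec : constantCoeff a = constantCoeff (t : Poly p) * c := (IsLocalization.lift_mk'_spec _ a c t).mp hc'
  rw [mem_maximalIdeal_range_iff, AddSubgroupClass.coe_sub, coe_rangeEquiv, coe_constι]
  have ht1 : ordV p (t : Poly p) = 1 := ordV_eq_one_of_not_mem p t.2
  have key : (algebraMap (S p) (K p) (IsLocalization.mk' (S p) a t) - algebraMap (ZMod p) (K p) c) *
      algebraMap (Poly p) (K p) t = algebraMap (Poly p) (K p) (a - C c * (t : Poly p)) := by
    rw [sub_mul, algebraMap_mk'_mul, IsScalarTower.algebraMap_apply (ZMod p) (Poly p) (K p), MvPolynomial.algebraMap_eq]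
    simp only [map_sub, map_mul]
  have hmem : a - C c * (t : Poly p) ∈ origin p := by
    rw [RingHom.mem_ker, map_sub, map_mul, constantCoeff_C, hspec, mul_comm, sub_self]
  have hval := congr_arg (ordVK p) key
  rw [map_mul, ordVK_algebraMap, ordVK_algebraMap, ht1, mul_one] at hval
  rw [hval]
  exact ordV_lt_one_of_mem p hmem

variable {p}
variable {x : Fin 3 → Rg p} (hx : Ideal.span (Set.range x) = maximalIdeal (Rg p))

include hx in
/-- **Reduction to constant coefficients**: `ord (f(θ) − f₀(θ)) > 0` where `f₀ = ev0 f ∈ 𝔽_p[T]`. [folklore] -/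
theorem ordVK_aeval_sub_aeval_map_lt_one (f : Polynomial (Rg p)) :
    ordVK p (Polynomial.aeval (theta p x) f - Polynomial.aeval (theta p x) (f.map (ev0 p))) < 1 := by
  rw [← aeval_map_constι p (theta p x), Polynomial.map_map, ← map_sub]
  refine ordVK_aeval_lt_one_of_coeff_mem hx fun i => ?_
  rw [Polynomial.coeff_sub, Polynomial.coeff_map, RingHom.comp_apply]
  exact sub_const_mem_maximalIdeal p _

include hx in
/-- `g(θ) ∈ O` for `g ∈ 𝔽_p[T]`. [folklore] -/
theorem ordVK_aeval_const_le_one (g : Polynomial (ZMod p)) : ordVK p (Polynomial.aeval (theta p x) g) ≤ 1 := by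
  rw [← aeval_map_constι p]; exact ordVK_aeval_le_one hx _

/-- `g(θ) ∈ R[θ]` for `g ∈ 𝔽_p[T]`. [folklore] -/
theorem aeval_const_mem_chart (g : Polynomial (ZMod p)) : Polynomial.aeval (theta p x) g ∈ chart p x := by
  rw [← aeval_map_constι p]; exact aeval_mem_chart _

include hx in
/-- **A nonzero `g ∈ 𝔽_p[T]` has `ord g(θ) = 0`** (its image over `R` has a unit coefficient; quasi-regularity). [folklore] -/
theorem eq_zero_of_ordVK_aeval_lt_one {g : Polynomial (ZMod p)} (h : ordVK p (Polynomial.aeval (theta p x) g) < 1) :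
    g = 0 := by
  by_contra hg
  obtain ⟨i, hi⟩ : ∃ i, g.coeff i ≠ 0 := by
    by_contra hcon
    push Not at hcon
    exact hg (Polynomial.ext fun i => by rw [hcon i, Polynomial.coeff_zero])
  have hunit : (g.map (constι p)).coeff i ∉ maximalIdeal (Rg p) := by
    rw [Polynomial.coeff_map]
    exact fun hm => (IsLocalRing.mem_maximalIdeal _).mp hm ((Ne.isUnit hi).map (constι p))
  have h1 := ordVK_aeval_eq_one_of_not_mem hx hunit
  rw [aeval_map_constι] at h1
  rw [h1] at h
  exact lt_irrefl _ h

/-! ## 2. CurveBlowupFacts (b) -/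

include hx in
/-- For the good index `b`, `D = u₀ ∂_b` moves `θ` by a unit: `ord (u₀ · ∂_b θ) = 0`. [folklore] -/
theorem ordVK_mul_pd_theta {b : Fin 3}
    (hb : ordVK p ((x 0 : K p) * pd p b (x 1 : K p) - (x 1 : K p) * pd p b (x 0 : K p)) = expNeg 1) :
    ordVK p ((x 0 : K p) * pd p b (theta p x)) = 1 := by
  have h0 := coe_rsop_ne_zero hx 0
  have e : (x 0 : K p) * pd p b (theta p x) =
      ((x 0 : K p) * pd p b (x 1 : K p) - (x 1 : K p) * pd p b (x 0 : K p)) / (x 0 : K p) := by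
    rw [theta, Derivation.leibniz_div]
    simp only [smul_eq_mul]
    field_simp
  rw [e, map_div₀, hb, ordVK_rsop hx 0, div_self (expNeg_ne_zero 1)]

include hx in
/-- **CurveBlowupFacts (b) for `B♯`**: if `u ∈ B♯` and `d ∈ K` satisfy `ord (u − d^p) > 0`, then `ord (u − e^p) > 0` for some
`e ∈ B♯`. [folklore] -/
theorem exists_pow_of_Bsharp (u : Bsharp p x) (d : K p) (hud : ordVK p ((u : K p) - d ^ p) < 1) :
    ∃ e : Bsharp p x, ordVK p ((u : K p) - (e : K p) ^ p) < 1 := by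
  have hpr : p.Prime := hp.out
  have hequiv := Valuation.isEquiv_valuation_valuationSubring (ordVK p)
  -- `u = y/z`, `y ≈ A₀(θ)`, `z ≈ Z₀(θ)` with constant coefficients
  obtain ⟨y, hy, z, hz, hvz, hu⟩ := u.2
  obtain ⟨A₁, rfl⟩ := exists_aeval_of_mem_chart hy
  obtain ⟨Z₁, rfl⟩ := exists_aeval_of_mem_chart hz
  set θ := theta p x with hθ
  set A₀ := A₁.map (ev0 p) with hA₀
  set Z₀ := Z₁.map (ev0 p) with hZ₀
  set y' := Polynomial.aeval θ A₀ with hy'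
  set z' := Polynomial.aeval θ Z₀ with hz'
  have hyy' : ordVK p (Polynomial.aeval θ A₁ - y') < 1 := ordVK_aeval_sub_aeval_map_lt_one hx A₁
  have hzz' : ordVK p (Polynomial.aeval θ Z₁ - z') < 1 := ordVK_aeval_sub_aeval_map_lt_one hx Z₁
  have hz1 : ordVK p (Polynomial.aeval θ Z₁) = 1 := hequiv.eq_one_iff_eq_one.mpr hvz
  have hy'1 : ordVK p y' ≤ 1 := ordVK_aeval_const_le_one hx A₀
  have hz'1 : ordVK p z' = 1 := by
    refine le_antisymm (ordVK_aeval_const_le_one hx Z₀) ?_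
    by_contra hlt
    rw [not_le] at hlt
    have : ordVK p (Polynomial.aeval θ Z₁) < 1 := by
      have e : Polynomial.aeval θ Z₁ = (Polynomial.aeval θ Z₁ - z') + z' := by ring
      rw [e]
      exact lt_of_le_of_lt (Valuation.map_add _ _ _) (max_lt hzz' hlt)
    rw [hz1] at this
    exact lt_irrefl _ this
  have hz0 : Polynomial.aeval θ Z₁ ≠ 0 := ne_zero_of_valuation_eq_one hvz
  have hz'0 : z' ≠ 0 := (Valuation.ne_zero_iff (ordVK p)).mp (by rw [hz'1]; exact one_ne_zero)
  have hvz' : (O p).valuation z' = 1 := hequiv.eq_one_iff_eq_one.mp hz'1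
  -- `u ≈ u' = y'/z'`
  set u' := y' / z' with hu'
  have huu' : ordVK p ((u : K p) - u') < 1 := by
    have e : (u : K p) - u' = ((Polynomial.aeval θ A₁ - y') * z' + y' * (z' - Polynomial.aeval θ Z₁)) /
        (Polynomial.aeval θ Z₁ * z') := by
      rw [hu, hu']
      field_simp
      ring
    rw [e, map_div₀, map_mul, hz1, hz'1, mul_one, div_one]
    refine lt_of_le_of_lt (Valuation.map_add _ _ _) (max_lt ?_ ?_)
    · rw [map_mul, hz'1, mul_one]; exact hyy'
    · rw [map_mul, ← neg_sub (Polynomial.aeval θ Z₁) z', Valuation.map_neg]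
      calc ordVK p y' * ordVK p (Polynomial.aeval θ Z₁ - z') ≤ 1 * ordVK p (Polynomial.aeval θ Z₁ - z') :=
            mul_le_mul' hy'1 le_rfl
        _ < 1 := by rw [one_mul]; exact hzz'
  have hu'd : ordVK p (u' - d ^ p) < 1 := by
    have e : u' - d ^ p = ((u : K p) - d ^ p) - ((u : K p) - u') := by ring
    rw [e]
    exact lt_of_le_of_lt (Valuation.map_sub _ _ _) (max_lt hud huu')
  -- apply `D = u₀ ∂_b`
  obtain ⟨b, hb⟩ := exists_ordVK_wronskian_eq hx
  have hDθ := ordVK_mul_pd_theta hx hb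
  set W₀ : Polynomial (ZMod p) := Z₀ * Polynomial.derivative A₀ - A₀ * Polynomial.derivative Z₀ with hW₀
  have hDu' : (x 0 : K p) * pd p b (u' - d ^ p) = (z'⁻¹) ^ 2 * Polynomial.aeval θ W₀ * ((x 0 : K p) * pd p b θ) := by
    rw [map_sub, pd_pow_p, sub_zero, hu', Derivation.leibniz_div, hy', hz', Derivation.map_aeval, Derivation.map_aeval]
    simp only [smul_eq_mul, hW₀, map_sub, map_mul]
    ring
  have hW : ordVK p (Polynomial.aeval θ W₀) < 1 := by
    have h1 : ordVK p ((x 0 : K p) * pd p b (u' - d ^ p)) < 1 :=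
      lt_of_le_of_lt (ordVK_mul_pd_le p b (ordVK_rsop hx 0) _) hu'd
    rw [hDu', map_mul, map_mul, hDθ, mul_one, map_pow, map_inv₀, hz'1, inv_one, one_pow, one_mul] at h1
    exact h1
  have hW0 : W₀ = 0 := eq_zero_of_ordVK_aeval_lt_one hx hW
  -- `(A₀ Z₀^{p-1})' = 0`, so `A₀ Z₀^{p-1} = H₀^p`
  set F₀ : Polynomial (ZMod p) := A₀ * Z₀ ^ (p - 1) with hF₀
  have hF₀' : Polynomial.derivative F₀ = 0 := by
    have hp1 : ((p - 1 : ℕ) : ZMod p) = -1 := by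
      rw [Nat.cast_sub hpr.one_lt.le, Nat.cast_one, ZMod.natCast_self, zero_sub]
    have hpow : Z₀ ^ (p - 1) = Z₀ ^ (p - 2) * Z₀ := by
      rw [← pow_succ]; congr 1; have := hpr.two_le; omega
    have hW' : Z₀ * Polynomial.derivative A₀ = A₀ * Polynomial.derivative Z₀ := sub_eq_zero.mp (hW₀ ▸ hW0)
    rw [hF₀, Polynomial.derivative_mul, Polynomial.derivative_pow, hp1, map_neg, map_one, hpow,
      show p - 1 - 1 = p - 2 by omega]
    calc Polynomial.derivative A₀ * (Z₀ ^ (p - 2) * Z₀) + A₀ * (-1 * Z₀ ^ (p - 2) * Polynomial.derivative Z₀)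
        = Z₀ ^ (p - 2) * (Z₀ * Polynomial.derivative A₀ - A₀ * Polynomial.derivative Z₀) := by ring
      _ = 0 := by rw [hW', sub_self, mul_zero]
  set H₀ : Polynomial (ZMod p) := Polynomial.contract p F₀ with hH₀
  have hHp : H₀ ^ p = F₀ := by
    rw [← ZMod.expand_card, hH₀, Polynomial.expand_contract p hF₀' hpr.ne_zero]
  -- `e = H₀(θ)/z'`
  have he : Polynomial.aeval θ H₀ / z' ∈ Bsharp p x := ⟨_, aeval_const_mem_chart H₀, z', aeval_const_mem_chart Z₀, hvz', rfl⟩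
  refine ⟨⟨_, he⟩, ?_⟩
  have hep : (Polynomial.aeval θ H₀ / z') ^ p = u' := by
    rw [div_pow, ← map_pow, hHp, hF₀, map_mul, map_pow, hu', hy', hz']
    rw [← pow_sub_one_mul hpr.ne_zero (Polynomial.aeval θ Z₀), mul_comm (Polynomial.aeval θ Z₀ ^ (p - 1)) (Polynomial.aeval θ Z₀),
      mul_div_mul_right _ _ (pow_ne_zero _ hz'0)]
  show ordVK p ((u : K p) - (Polynomial.aeval θ H₀ / z') ^ p) < 1
  rw [hep]
  exact huu'

end OrdWitness

end Summit.ResolutionOfSingularities.ResolutionOfSingularities.Theorems.CleanModels.Negative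

end
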